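import Summits.QuantumFields.YangMills.Theorems.BalabanUVNodesN28AtBetaOfRecord

/-!
# BalabanUVNodes ∕ N28 — THE `γc`-CAP OF BINDER (B4) AT THE β OF RECORD, AS AN `iff`
# (Track A, DAG node N28 of 28 = binder B6 «`0 < β̄`, `0 < γc`»; YM-PLAN §2d row B6; count-neutral)

HONEST FRAMING.  Count-neutral, elementary kernel bookkeeping about the β-FIELD OF RECORD
`Node00.betaOfMerged βm β⁰ γ = β⁰ + 𝟙_{]0,γ]^{k+1}}·(βm − β⁰)` (`Node00/BetaOfRecord.lean`, p410806; the Stage-8 definer's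
assembly line reads it at `βm :=` the merged β of record, `β⁰ := beta0OfMerged …`, `γ := θ.γ`).  NOT a node discharge, not an
estimate; `βm`, `β⁰`, `γ` are PARAMETERS — nothing of Bałaban's β is asserted.  N28 is VACATED and closes WITH N25.  One finite
four-torus programme at fixed `ε`; nothing continuum ∕ ℝ⁴ ∕ OS ∕ mass-gap ∕ Clay.  0 `def`, 0 `sorry`, standard axioms.

WHAT IS PROVED.  `Summits/…/BalabanUVNodesN28AtBetaOfRecord.lean` (p412300) §2 showed by ONE witness of the printed shape
(`β_merged = 1 + g_k`) that binder (B4) `BetaContH γc` of the β of record can FAIL on every box larger than the record box,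
`γc > γ > 0` (`exists_printedShape_gammaCap`).  This module replaces the witness by the exact criterion:
* `merged_eq_beta0_on_outerFace_of_betaContH` — if `BetaContH γc (betaOfMerged βm β⁰ γ)` holds with `γ < γc`, then at EVERY history
  `v` of the record box `]0,γ]^{k+1}` with a coordinate on the OUTER FACE (`v i = γ` for some `i`) the merged β equals the one-loop
  number, `βm k v = β⁰ k` (push `v i` slightly above `γ`: those histories are in the bigger box but off the record box, where the β
  of record is `β⁰ k`; continuity within the bigger box at `v`, where it is `βm k v`, and `tendsto_nhds_unique`);
* `betaContH_betaOfMerged_of_face` — conversely, (B4) on the record box for `βm` plus `βm = β⁰` on the outer face give (B4) for the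
  β of record on EVERY bigger box (pasting along the two relatively closed pieces `]0,γ]^{k+1}` and `{v : ∃ i, γ ≤ v i}`);
* `betaContH_betaOfMerged_iff_of_lt` — for `γ < γc`: `BetaContH γc (betaOfMerged βm β⁰ γ) ↔ BetaContH γ βm ∧ (βm = β⁰ on the outer
  face of the record box)`.
CONSEQUENCE FOR N28 AT D₀ (located, not asserted): the (B4)-witness `γc` at a Stage-8 record is the record's own box side `θ.γ`
(or anything smaller, p412300 `b4_with_sideCondition_atRecord`); a LARGER `γc` is not a free choice but a CONSTRAINT on Bałaban's
merged β — it must sit at its one-loop value on the whole outer face `max_i g_i = θ.γ` — so every β-side road instantiated at D₀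
takes its box `γ₀ ≤ θ.γ` (as dag-n26-a's sockets and the record's γ-clause `w.γ ≤ θ.γ` do).
Sources: T. Bałaban, CMP **109** (1987) 249–301 [Balaban1987RG1] (1.22) p. 264 («defined on the interval [0, γ]»); CMP **122**
(1989) 355–392 [Balaban1989LargeFieldII] Thm 1 p. 355 («sufficiently small positive γ»).  Nothing here is a claim about the
Yang–Mills mass gap.
-/

namespace Summit.QuantumFields.YangMills.BalabanUVNodes.N28GammaCap

open Literature.MathematicalPhysics.QuantumFieldTheory.Balaban1983to89
open Literature.MathematicalPhysics.QuantumFieldTheory.Balaban1983to89.FlowStep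
open Literature.MathematicalPhysics.QuantumFieldTheory.Balaban1983to89.Node00 (betaOfMerged betaOfMerged_of_mem
  betaOfMerged_of_notMem)
open Summit.QuantumFields.YangMills.BalabanUVNodes.N28AtBetaOfRecord (betaOfMerged_eqOn betaContH_merged_of_betaOfMerged)
open Filter Topology

variable {βm : HBeta} {β0 : ℕ → ℝ} {γ γc : ℝ}

/-- **(B4) BEYOND THE RECORD BOX PINS THE MERGED β ON THE OUTER FACE.**  If the β of record `betaOfMerged βm β⁰ γ` is jointly
continuous on a box `]0,γc]^{k+1}` with `γ < γc`, then at every history `v ∈ ]0,γ]^{k+1}` with some coordinate on the outer face,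
`v i = γ`, the merged β equals the one-loop number: `βm k v = β⁰ k`.  Along the ray `t ↦ update v i t`, `t ↓ γ`: for
`t ∈ ]γ, γc[` the history is in the bigger box and OFF the record box (value `β⁰ k`), at `t = γ` it is `v` (value `βm k v`).
[cite: Balaban1987RG1, (1.22) p.264 («defined on the interval [0, γ]»)] -/
theorem merged_eq_beta0_on_outerFace_of_betaContH (hlt : γ < γc) (hC : BetaContH γc (betaOfMerged βm β0 γ))
    {k : ℕ} {v : Fin (k + 1) → ℝ} (hv : v ∈ Box γ k) {i : Fin (k + 1)} (hi : v i = γ) : βm k v = β0 k := by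
  have hγ : 0 < γ := hi ▸ ((mem_box.mp hv) i).1
  have hvc : v ∈ Box γc k := box_mono hlt.le k hv
  have hray : Continuous fun t : ℝ => Function.update v i t := by
    refine continuous_pi fun j => ?_
    by_cases hj : j = i
    · subst hj; simpa only [Function.update_self] using continuous_id'
    · simpa only [Function.update_of_ne hj] using continuous_const
  have hmaps : Set.MapsTo (fun t : ℝ => Function.update v i t) (Set.Ioo γ γc) (Box γc k) := by
    intro t ht
    show Function.update v i t ∈ Box γc k
    refine mem_box.mpr fun j => ?_
    by_cases hj : j = i
    · subst hj; rw [Function.update_self]; exact ⟨hγ.trans ht.1, ht.2.le⟩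
    · rw [Function.update_of_ne hj]; exact (mem_box.mp hvc) j
  have hoff : ∀ t ∈ Set.Ioo γ γc,
      (betaOfMerged βm β0 γ k ∘ fun t : ℝ => Function.update v i t) t = β0 k := by
    intro t ht
    show betaOfMerged βm β0 γ k (Function.update v i t) = β0 k
    refine betaOfMerged_of_notMem βm β0 γ fun hm => ?_
    have h : Function.update v i t i ≤ γ := ((mem_box.mp hm) i).2
    rw [Function.update_self] at h
    exact (not_le.mpr ht.1) h
  have hat : Function.update v i γ = v := by rw [← hi, Function.update_eq_self]
  have hcomp : ContinuousWithinAt (betaOfMerged βm β0 γ k ∘ fun t : ℝ => Function.update v i t) (Set.Ioo γ γc) γ := by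
    have h := hC k v hvc
    rw [← hat] at h
    exact h.comp hray.continuousWithinAt hmaps
  have h1 : Tendsto (betaOfMerged βm β0 γ k ∘ fun t : ℝ => Function.update v i t) (𝓝[Set.Ioo γ γc] γ)
      (𝓝 (βm k v)) := by
    have ht := hcomp.tendsto
    simp only [Function.comp_apply, hat, betaOfMerged_of_mem βm β0 γ hv] at ht
    exact ht
  have h2 : Tendsto (betaOfMerged βm β0 γ k ∘ fun t : ℝ => Function.update v i t) (𝓝[Set.Ioo γ γc] γ) (𝓝 (β0 k)) :=
    tendsto_const_nhds.congr' (eventually_nhdsWithin_of_forall fun t ht => (hoff t ht).symm)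
  rw [nhdsWithin_Ioo_eq_nhdsGT hlt] at h1 h2
  exact tendsto_nhds_unique h1 h2

/-- … in particular at the diagonal corner `(γ, …, γ)` of the record box (`γ > 0`): `βm k (γ,…,γ) = β⁰ k` for every `k`.
[cite: Balaban1987RG1, (1.22) p.264] -/
theorem merged_const_eq_beta0_of_betaContH (hγ : 0 < γ) (hlt : γ < γc) (hC : BetaContH γc (betaOfMerged βm β0 γ))
    (k : ℕ) : βm k (fun _ => γ) = β0 k :=
  merged_eq_beta0_on_outerFace_of_betaContH hlt hC (mem_box.mpr fun _ => ⟨hγ, le_rfl⟩) (i := Fin.last k) rfl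

/-- **THE CONVERSE: pasting.**  If the merged β is jointly continuous on the record box `]0,γ]^{k+1}` at every scale and equals its
one-loop number on the outer face, then the β of record is jointly continuous on every box `]0,γc]^{k+1}`, `γ ≤ γc`: the bigger box is
the union of the two relatively closed pieces `]0,γ]^{k+1}` (where the β of record is `βm`) and `{v : ∃ i, γ ≤ v i}` (where it is
the constant `β⁰ k`, by the face hypothesis on the overlap), each avoiding the closure of the other off itself.
[cite: Balaban1987RG1, (1.22) p.264] -/
theorem betaContH_betaOfMerged_of_face (hle : γ ≤ γc) (hA : BetaContH γ βm)
    (hF : ∀ k (v : Fin (k + 1) → ℝ), v ∈ Box γ k → ∀ i, v i = γ → βm k v = β0 k) :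
    BetaContH γc (betaOfMerged βm β0 γ) := by
  intro k
  -- the β of record on the two pieces
  have hfA : ContinuousOn (betaOfMerged βm β0 γ k) (Box γ k) := (hA k).congr (betaOfMerged_eqOn le_rfl k)
  have hfB : ContinuousOn (betaOfMerged βm β0 γ k) {v | v ∈ Box γc k ∧ ∃ i, γ ≤ v i} := by
    refine (continuousOn_const (c := β0 k)).congr fun v hv => ?_
    by_cases hvA : v ∈ Box γ k
    · obtain ⟨i, hi⟩ := hv.2
      rw [betaOfMerged_of_mem βm β0 γ hvA]
      exact hF k v hvA i (le_antisymm ((mem_box.mp hvA) i).2 hi)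
    · exact betaOfMerged_of_notMem βm β0 γ hvA
  -- the pieces cover the bigger box
  have hcover : Box γc k ⊆ Box γ k ∪ {v | v ∈ Box γc k ∧ ∃ i, γ ≤ v i} := fun v hv => by
    by_cases hvA : v ∈ Box γ k
    · exact Or.inl hvA
    · refine Or.inr ⟨hv, ?_⟩
      by_contra hne
      push Not at hne
      exact hvA (mem_box.mpr fun i => ⟨((mem_box.mp hv) i).1, (hne i).le⟩)
  -- each piece avoids the closure of the other off itself (within the bigger box)
  have hAcl : ∀ v ∈ Box γc k, v ∉ Box γ k → v ∉ closure (Box γ k) := by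
    intro v hv hvA hcl
    obtain ⟨i, hi⟩ : ∃ i, γ < v i := by
      by_contra hne
      push Not at hne
      exact hvA (mem_box.mpr fun i => ⟨((mem_box.mp hv) i).1, hne i⟩)
    have hsub : closure (Box γ k) ⊆ {w : Fin (k + 1) → ℝ | w i ≤ γ} :=
      closure_minimal (fun w hw => ((mem_box.mp hw) i).2) (isClosed_le (continuous_apply i) continuous_const)
    exact (not_le.mpr hi) (hsub hcl)
  have hBcl : ∀ v ∈ Box γc k, v ∉ {v | v ∈ Box γc k ∧ ∃ i, γ ≤ v i} →
      v ∉ closure {v | v ∈ Box γc k ∧ ∃ i, γ ≤ v i} := by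
    intro v hv hvB hcl
    have hall : ∀ i, v i < γ := by
      by_contra hne
      push Not at hne
      obtain ⟨i, hi⟩ := hne
      exact hvB ⟨hv, i, hi⟩
    have hsub : closure {v | v ∈ Box γc k ∧ ∃ i, γ ≤ v i} ⊆ ⋃ i, {w : Fin (k + 1) → ℝ | γ ≤ w i} :=
      closure_minimal (fun w hw => by
          obtain ⟨i, hi⟩ := hw.2
          exact Set.mem_iUnion.mpr ⟨i, hi⟩)
        (isClosed_iUnion_of_finite fun i => isClosed_le continuous_const (continuous_apply i))
    obtain ⟨i, hi⟩ := Set.mem_iUnion.mp (hsub hcl)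
    exact (not_lt.mpr hi) (hall i)
  -- paste
  have hAB : ContinuousOn (betaOfMerged βm β0 γ k) (Box γ k ∪ {v | v ∈ Box γc k ∧ ∃ i, γ ≤ v i}) := by
    intro v hv
    have hvc : v ∈ Box γc k := hv.elim (fun h => box_mono hle k h) (fun h => h.1)
    refine ContinuousWithinAt.union ?_ ?_
    · by_cases hvA : v ∈ Box γ k
      · exact hfA v hvA
      · exact continuousWithinAt_of_notMem_closure (hAcl v hvc hvA)
    · by_cases hvB : v ∈ {v | v ∈ Box γc k ∧ ∃ i, γ ≤ v i}
      · exact hfB v hvB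
      · exact continuousWithinAt_of_notMem_closure (hBcl v hvc hvB)
  exact hAB.mono hcover

/-- **THE `γc`-CAP AS AN `iff`.**  For a box larger than the record box, `γ < γc`: binder (B4) holds for the β of record on
`]0,γc]^{k+1}` (all `k`) iff it holds for the MERGED β on the record box `]0,γ]^{k+1}` AND the merged β sits at its one-loop number
on the whole outer face `{v ∈ ]0,γ]^{k+1} : ∃ i, v i = γ}`.  So at the datum of record N28's second witness `γc` exceeds the record's
`θ.γ` only under that constraint on Bałaban's β — generically `γc ≤ θ.γ`. [cite: Balaban1987RG1, (1.22) p.264] -/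
theorem betaContH_betaOfMerged_iff_of_lt (hlt : γ < γc) :
    BetaContH γc (betaOfMerged βm β0 γ) ↔
      BetaContH γ βm ∧ ∀ k (v : Fin (k + 1) → ℝ), v ∈ Box γ k → ∀ i, v i = γ → βm k v = β0 k :=
  ⟨fun h => ⟨betaContH_merged_of_betaOfMerged hlt.le le_rfl h,
      fun _ _ hv _ hi => merged_eq_beta0_on_outerFace_of_betaContH hlt h hv hi⟩,
    fun h => betaContH_betaOfMerged_of_face hlt.le h.1 h.2⟩

/-- **Packaged for N28.**  If the merged β is NOT at its one-loop number somewhere on the outer face of the record box (one history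
`v ∈ ]0,γ]^{k+1}` with `v i = γ` and `βm k v ≠ β⁰ k`), then binder (B4) for the β of record fails on EVERY larger box: the
(B4)-witness `γc` at such a record is at most `γ`. [cite: Balaban1989LargeFieldII, Thm 1 p.355 («sufficiently small positive γ»)] -/
theorem not_betaContH_betaOfMerged_of_face_ne {k : ℕ} {v : Fin (k + 1) → ℝ} (hv : v ∈ Box γ k) {i : Fin (k + 1)}
    (hi : v i = γ) (hne : βm k v ≠ β0 k) (hlt : γ < γc) : ¬ BetaContH γc (betaOfMerged βm β0 γ) :=
  fun h => hne (merged_eq_beta0_on_outerFace_of_betaContH hlt h hv hi)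

/-- … so every (B4)-witness of such a record is capped: `BetaContH γc (betaOfMerged βm β⁰ γ) → γc ≤ γ`.
[cite: Balaban1989LargeFieldII, Thm 1 p.355] -/
theorem gammaCap_of_face_ne {k : ℕ} {v : Fin (k + 1) → ℝ} (hv : v ∈ Box γ k) {i : Fin (k + 1)} (hi : v i = γ)
    (hne : βm k v ≠ β0 k) (hC : BetaContH γc (betaOfMerged βm β0 γ)) : γc ≤ γ :=
  not_lt.mp fun hlt => not_betaContH_betaOfMerged_of_face_ne hv hi hne hlt hC

end Summit.QuantumFields.YangMills.BalabanUVNodes.N28GammaCap
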